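import Literature.MathematicalPhysics.QuantumFieldTheory.Balaban1983to89.B6Eq238TwoLevelBox

/-!
# `Balaban1983to89.B6Ineq249TwoLevelBox` — [B6] (2.49) `|Rλ| ≤ O(M^{−1})|λ|` and (2.50) `G′ = G′₀(I − R)^{−1} = G′₀Σ_nRⁿ`,
convergent in the `L^∞` operator norm, FOR THE GENUINE TWO-LEVEL OPERATOR ON A BOX OF `L`-BLOCKS — the parametrix series
IS the propagator `(Δ_Ω^{L^{−j},N} + Q′*aQ′)^{−1} = B6Ineq243TwoLevelBox.gTwoLevel` of the box (file 3/3 of the two-level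
parametrix; no existing module is touched; no fact is minted)

FRAMING (verbatim cell line):
statement-level skeleton of published theorems with citation tags; proofs where landed; nothing here is a claim about the Yang–Mills mass gap

Source under audit (cell pub-balaban): T. Bałaban, *Propagators and renormalization transformations for lattice gauge
theories. II*, Commun. Math. Phys. **96** (1984) 223–250 [`Balaban1984PropagatorsII`, "B6"], p. 230 [PDF 8] (2.44), p. 232
[PDF 10] (2.49)–(2.51), p. 234 [PDF 12] Proposition 2.2 (last sentence) (renders
`b2b-balaban-ref1/pages/1984-cmp96-propagators-rt-II/…-p008/p010/p012-x2.png`, read as images this generation).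

## WHAT IS PRINTED (p. 232, verbatim up to notation)

«Now let us come back to the inequality (2.44) and its consequences. One of them follows from the equality (2.38) where
the operator R was defined. We get |Rλ| ≤ O(M^{−1})|λ|, (2.49) thus the operator R has a small norm in the space L^∞ for
M sufficiently large, and we get G′ = G′₀(I − R)^{−1} = G′₀Σ_{n=0}^∞ Rⁿ = Σ_ω h_{□₀}G′(□₀)h_{□₀}K(h_{□₁})G′(□₁)h_{□₁}·…·
K(h_{□ₙ})G′(□ₙ)h_{□ₙ}, (2.50) … Both series above are convergent in the space L^∞»; p. 234, Proposition 2.2: «The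
expansion (2.50) is convergent in the L^∞ operator norm».

## WHAT THIS FILE CERTIFIES (kernel-checked; `A = 0`; the lineage is USED, not re-proved)

Setting of `B6Eq238TwoLevelBox` (`L = ℓ + 1`, `n = L^k`, cube half-width `M = L·M_h` unit blocks, `N = nM`, box
`Ω = Π_μ[0, N·P_μ)` of `L`-blocks, `Λ` a union of `L`-blocks, `E = twoLevelOp n ℓ a_j a m² (M_h·P) Λ`,
`R = B6Eq250.rOp E hDiag gPad = Σ_q resᵀ·K_q(h_q)G′(□_q)h_q·res`, `G′₀ = B6Eq250.gZero hDiag gPad`), in the matrix ring of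
`Ω` with Mathlib's `ℓ^∞ → ℓ^∞` operator norm (scope `Matrix.Norms.Operator`: `‖A‖ = max_x Σ_{x′}|A(x,x′)|`, the printed
«norm in the space L^∞»):
* §1 `linfty_opNorm_le_of_pointwise` (the operator norm from a pointwise bound), `sum_le_card_mul` (a sum with at most
  `|T|` non-zero terms);
* §2 **the row support of the terms**: a term `resᵀK_q(h_q)G′(□_q)h_q res` (resp. `h_qG′(□_q)h_q`) can be non-zero at `x`
  only if `|x_μ + ½ − Nq_μ| < N` for every `μ` (`abs_lt_of_bPad_ne_zero`, needs `M_h ≥ 3`, i.e. `⅜M ≥ L` — the range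
  `≤ L` unit blocks of `E_q` against the margin `⅜M` of the cut-off; resp. `abs_lt_of_aPad_ne_zero`), so at most
  `2^{d+1}` centres contribute to a row (`card_near_le`);
* §3 **(2.49)** `norm_rOp_le`: there is `C′ = C′(d, ℓ, window)` with `‖R‖ ≤ C′/M` for EVERY `k ≥ 1` (mesh), `M_h ≥ 3`,
  volume `P`, block union `Λ` and window point — from gen-7's (2.44) `B6Ineq243TwoLevelBox.ineq244_twoLevel` per cube
  with the sizes `κ₁ = (d+1)sup|h′|/M`, `κ₂ = (d+1)sup|h″|/M²` of `B6Partition236TwoLevelBox`; and `norm_gZero_le`: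
  `‖G′₀‖ ≤ 2^{d+1}c′` from (2.43)₁ (`ineq243_twoLevel_rowSum_colSum`);
* §4 **(2.50)** `eq250_twoLevelBox` (one theorem, five conjuncts): for `M ≥ M₀ = 2C′` («M sufficiently large») and
  `M_h ≥ 3`: `‖R‖ ≤ ½`; `E·(G′₀Σ'_nRⁿ) = 1` (`B6Eq250.series_right_inverse`); the series EQUALS the propagator of the box,
  `(Δ_Ω + Q′*aQ′)^{−1} = gTwoLevel = G′₀Σ'_nRⁿ`, and `HasSum (G′₀Rⁿ) gTwoLevel`, i.e. (2.50) converges to it in the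
  `ℓ^∞ → ℓ^∞` operator norm (`B6Eq250.left_inverse_eq_series`/`neumann250` with gen-7's `gTwoLevel_mul_twoLevelOp`); and
  the uniform bound `‖(Δ_Ω + Q′*aQ′)^{−1}‖_{∞→∞} ≤ C″ = 2^{d+2}c′`;
* §5 (v1.1) **(2.51)** `ineq251_twoLevelBox`: the decaying form `|(Rλ)(x)| ≤ (C′/M)e^{−δ′D/n}F` for `|λ| ≤ F` supported
  at sup-distance `≥ D` from `x` («|(Rλ)(x)| ≤ O(M^{−1})e^{−δ₀d(x,y)}|λ| if supp λ ⊂ B^j(y)», in the support-distance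
  form of gen-7's (2.44)), same uniformity.

## HONEST SCOPE

`k = 1` (two levels), `A = 0`, Neumann box for the torus, one cube size (cf. `B6Partition236TwoLevelBox`); `M_h ≥ 3` for
the row count; constants existential (functions of `d`, `ℓ` and the window, no numerical values); the third member of
(2.50) (the sum over walks) and the Hölder-norm convergence are NOT treated here (`B6Eq250.neumann250_walks` is the
abstract walk form).  The uniform `ℓ^∞` bound of the box propagator also follows DIRECTLY from (2.43)₁ on `Ω`
(`ineq243_twoLevel_rowSum_colSum`), since `Ω` is itself a box; the point of this file is the printed ROUTE (2.38) →
(2.49) → (2.50) for the genuine objects.  Nothing is inferred from the manuscript: every step is kernel-checked.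
-/

namespace Literature.MathematicalPhysics.QuantumFieldTheory.Balaban1983to89.B6Ineq249TwoLevelBox

open Finset Matrix
open scoped Matrix.Norms.Operator
open Literature.MathematicalPhysics.QuantumFieldTheory.Balaban1983to89.B4Reflection242 (boxDom mem_boxDom nbrs mem_nbrs
  blk neumannLapK diagK avgK)
open Literature.MathematicalPhysics.QuantumFieldTheory.Balaban1983to89.B4Green242Bridge (boxNbrs)
open Literature.MathematicalPhysics.QuantumFieldTheory.Balaban1983to89.B4ContourShift (supNorm abs_le_supNorm supNorm_nonneg)
open Literature.MathematicalPhysics.QuantumFieldTheory.Balaban1983to89.B4Lemma22ReduceZero (Box)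
open Literature.MathematicalPhysics.QuantumFieldTheory.Balaban1983to89.B4PartitionUnity22 (hprof D1 D2 D1_nonneg D2_nonneg
  contDiff_hprof hasCompactSupport_hprof)
open Literature.MathematicalPhysics.QuantumFieldTheory.Balaban1983to89.B6Ineq243TwoLevelBox
open Literature.MathematicalPhysics.QuantumFieldTheory.Balaban1983to89.B6Partition236TwoLevelBox
open Literature.MathematicalPhysics.QuantumFieldTheory.Balaban1983to89.B6Eq238TwoLevelBox

noncomputable section

variable {d : ℕ}

/-! ## §1 Norm tools: the `ℓ^∞` operator norm from pointwise bounds -/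

section NormTools

variable {m m' : Type*} [Fintype m] [Fintype m']

/-- `‖A‖_{∞→∞} ≤ C` as soon as `|(Av)(i)| ≤ C‖v‖_∞` for all `v`, `i` (Mathlib: the `linfty` operator norm IS the operator
norm on `ℓ^∞`). [cite: Balaban1984PropagatorsII, (2.49) p.232 («the operator R has a small norm in the space L^∞»), dictionary] -/
theorem linfty_opNorm_le_of_pointwise (A : Matrix m m' ℝ) {C : ℝ} (hC : 0 ≤ C)
    (h : ∀ (v : m' → ℝ) (i : m), |(A *ᵥ v) i| ≤ C * ‖v‖) : ‖A‖ ≤ C := by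
  rw [Matrix.linfty_opNorm_eq_opNorm]
  refine ContinuousLinearMap.opNorm_le_bound _ hC fun v => ?_
  rw [pi_norm_le_iff_of_nonneg (by positivity)]
  intro i
  have := h v i
  simpa [Real.norm_eq_abs] using this

/-- `|v(j)| ≤ ‖v‖_∞`. [folklore] -/
private theorem abs_apply_le_norm (v : m' → ℝ) (j : m') : |v j| ≤ ‖v‖ := by
  have := norm_le_pi_norm v j
  rwa [Real.norm_eq_abs] at this

/-- a sum of non-negative terms, each `≤ B`, with at most the terms indexed (injectively) by `T` non-zero, is `≤ |T|·B`.
[folklore] -/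
private theorem sum_le_card_mul {ι σ : Type*} [Fintype ι] [DecidableEq σ] (f : ι → ℝ) (key : ι → σ)
    (hkey : Function.Injective key) (T : Finset σ) (hT : ∀ i, f i ≠ 0 → key i ∈ T) {B : ℝ} (hB : 0 ≤ B)
    (hf : ∀ i, f i ≤ B) : ∑ i, f i ≤ T.card * B := by
  classical
  rw [← Finset.sum_filter_ne_zero]
  have hcard : (Finset.univ.filter fun i => f i ≠ 0).card ≤ T.card :=
    Finset.card_le_card_of_injOn key (fun i hi => by
      rw [Finset.coe_filter] at hi; exact hT i hi.2) (fun i _ j _ h => hkey h)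
  calc ∑ i ∈ Finset.univ.filter (fun i => f i ≠ 0), f i
      ≤ (Finset.univ.filter fun i => f i ≠ 0).card • B := Finset.sum_le_card_nsmul _ _ _ fun i _ => hf i
    _ = ((Finset.univ.filter fun i => f i ≠ 0).card : ℝ) * B := by rw [nsmul_eq_mul]
    _ ≤ T.card * B := by gcongr

omit [Fintype m] in
/-- `|(Aw)(i)| ≤ (Σ_j |A(i,j)|)·F` when `|w| ≤ F`. [folklore] -/
private theorem abs_mulVec_le_rowSum_mul (A : Matrix m m' ℝ) (w : m' → ℝ) (i : m) {F : ℝ} (hw : ∀ j, |w j| ≤ F) :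
    |(A *ᵥ w) i| ≤ (∑ j, |A i j|) * F := by
  simp only [Matrix.mulVec, dotProduct]
  rw [Finset.sum_mul]
  refine (Finset.abs_sum_le_sum_abs _ _).trans (Finset.sum_le_sum fun j _ => ?_)
  rw [abs_mul]
  exact mul_le_mul_of_nonneg_left (hw j) (abs_nonneg _)

/-- `‖1‖_{∞→∞} ≤ 1`. [folklore] -/
private theorem linfty_opNorm_one_le [DecidableEq m] : ‖(1 : Matrix m m ℝ)‖ ≤ 1 :=
  linfty_opNorm_le_of_pointwise _ zero_le_one fun v i => by rw [Matrix.one_mulVec, one_mul]; exact abs_apply_le_norm v i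

end NormTools

/-! ## §2 The row supports: at most `2^{d+1}` centres contribute at a site -/

section Support

variable {ℓ k Mh : ℕ} {P : Fin (d + 1) → ℕ} {q : Fin (d + 1) → ℤ}

/-- the `≤ 2^{d+1}` candidate centres at a fine site: `q_μ ∈ {⌊t_μ⌋, ⌊t_μ⌋ + 1}`, `t_μ = (x_μ + ½)/N`.
[cite: Balaban1984PropagatorsII, p.229 (the cover by cubes of size 2M: finite overlap), dictionary] -/
def near (N : ℕ) (x : Fin (d + 1) → ℤ) : Finset (Fin (d + 1) → ℤ) :=
  Fintype.piFinset fun μ => ({⌊pos x μ / (N : ℝ)⌋, ⌊pos x μ / (N : ℝ)⌋ + 1} : Finset ℤ)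

/-- at most `2^{d+1}` candidate centres. [cite: Balaban1984PropagatorsII, p.229, dictionary] -/
theorem card_near_le (N : ℕ) (x : Fin (d + 1) → ℤ) : (near N x).card ≤ 2 ^ (d + 1) := by
  unfold near
  rw [Fintype.card_piFinset]
  calc ∏ μ : Fin (d + 1), ({⌊pos x μ / (N : ℝ)⌋, ⌊pos x μ / (N : ℝ)⌋ + 1} : Finset ℤ).card
      ≤ ∏ _μ : Fin (d + 1), 2 := Finset.prod_le_prod' fun μ _ => Finset.card_le_two
    _ = 2 ^ (d + 1) := by rw [Finset.prod_const, Finset.card_univ, Fintype.card_fin]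

/-- a centre within (open) distance `N` of the site in every coordinate is a candidate centre.
[cite: Balaban1984PropagatorsII, p.229, dictionary] -/
theorem mem_near_of_abs_lt {N : ℕ} (hN : 1 ≤ N) {x q : Fin (d + 1) → ℤ}
    (h : ∀ μ, |pos x μ - (N : ℝ) * q μ| < N) : q ∈ near N x := by
  have hNr : (0 : ℝ) < N := by exact_mod_cast hN
  unfold near
  rw [Fintype.mem_piFinset]
  intro μ
  rw [Finset.mem_insert, Finset.mem_singleton]
  have hμ := h μ
  rw [abs_lt] at hμ
  obtain ⟨h1, h2⟩ := hμ
  have ht2 : pos x μ / (N : ℝ) < q μ + 1 := by rw [div_lt_iff₀ hNr]; linarith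
  have ht1 : (q μ : ℝ) - 1 < pos x μ / (N : ℝ) := by rw [lt_div_iff₀ hNr]; linarith
  have hq1 : ⌊pos x μ / (N : ℝ)⌋ ≤ q μ := by
    have : (⌊pos x μ / (N : ℝ)⌋ : ℝ) < q μ + 1 := lt_of_le_of_lt (Int.floor_le _) ht2
    have : ⌊pos x μ / (N : ℝ)⌋ < q μ + 1 := by exact_mod_cast this
    omega
  have hq2 : q μ ≤ ⌊pos x μ / (N : ℝ)⌋ + 1 := by
    have : q μ - 1 ≤ ⌊pos x μ / (N : ℝ)⌋ := Int.le_floor.2 (by push_cast; exact ht1.le)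
    omega
  omega

/-- **THE RANGE OF THE TWO-LEVEL OPERATOR**: a non-zero entry `E(x, x″)` joins sites at sup-distance `≤ nL` (neighbours,
or sites of a common unit or `L`-block). [cite: Balaban1984PropagatorsII, (2.40)–(2.41) p.230] -/
theorem supNorm_le_of_twoLevelOp_ne_zero {n ℓ' : ℕ} (hn : 1 ≤ n) (aj a m2 : ℝ) {M' : Fin (d + 1) → ℕ}
    {Λ' : Finset ↥(boxDom (fun i => (ℓ' + 1) * M' i))} (hΛ : IsBlockUnion ℓ' M' Λ')
    {x x'' : ↥(boxDom (fun i => n * ((ℓ' + 1) * M' i)))} (h : twoLevelOp n ℓ' aj a m2 M' Λ' x x'' ≠ 0) :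
    supNorm (x.1 - x''.1) ≤ (n : ℝ) * ((ℓ' : ℝ) + 1) := by
  have hn1 : (1 : ℝ) ≤ (n : ℝ) * ((ℓ' : ℝ) + 1) := by
    have : (1 : ℝ) ≤ n := by exact_mod_cast hn
    nlinarith [(Nat.cast_nonneg ℓ' : (0 : ℝ) ≤ ℓ')]
  rw [twoLevelOp_apply' hn aj a m2 hΛ] at h
  by_cases hv : vEntry hn ℓ' aj a Λ' x x'' = 0
  · rw [hv, add_zero] at h
    by_cases he : x''.1 = x.1
    · rw [he, sub_self, B4BoxCov237.supNorm_zero']; positivity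
    · have hnb : x''.1 ∈ nbrs x.1 := by
        by_contra hnb
        apply h
        unfold neumannLapK diagK
        rw [if_neg he, if_neg hnb, if_neg he]; simp
      have hmem : x'' ∈ boxNbrs _ x := by
        unfold boxNbrs; simp only [Finset.mem_filter, Finset.mem_univ, true_and]; exact hnb
      have := supNorm_sub_le_one_of_mem_boxNbrs hmem
      rw [show x.1 - x''.1 = -(x''.1 - x.1) by abel, B4TorusKernel.supNorm_neg]
      linarith
  · exact supNorm_le_of_vEntry_ne_zero hn ℓ' aj a Λ' hv

/-- the geometry `N = nLM_h ≥ 4` of the setting. [folklore] -/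
private theorem four_le_N (hℓ : 1 ≤ ℓ) (hk : 1 ≤ k) (hMh : 1 ≤ Mh) : 4 ≤ (ℓ + 1) ^ k * ((ℓ + 1) * Mh) := by
  have h2 : 2 ≤ (ℓ + 1) ^ k := by
    calc 2 = 2 ^ 1 := by norm_num
      _ ≤ (ℓ + 1) ^ 1 := Nat.pow_le_pow_left (by omega) 1
      _ ≤ (ℓ + 1) ^ k := Nat.pow_le_pow_right (by omega) hk
  have : 2 ≤ (ℓ + 1) * Mh := by nlinarith
  nlinarith

/-- the centre seen from `Ω`: `pos(emb c) − Nq = pos(c) − N·locLabel q`. [cite: Balaban1983RegularityDecay, §2 p.575] -/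
theorem pos_emb (hP : ∀ i, 1 ≤ P i) (hq : q ∈ ctrs P)
    (c : ↥(Box d ℓ k (fun i => (ℓ + 1) * cubeM' Mh P q i))) (μ : Fin (d + 1)) :
    pos (emb ℓ k Mh P q hP hq c).1 μ = pos c.1 μ + (((ℓ + 1) ^ k * ((ℓ + 1) * Mh) : ℕ) : ℝ) * (cubeLo q μ : ℝ) := by
  rw [emb_val hP hq]
  simp only [pos, Pi.add_apply]
  push_cast
  ring

/-- … hence `pos(emb c) − Nq = pos(c) − N·locLabel q`. [cite: Balaban1983RegularityDecay, §2 p.575] -/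
theorem pos_emb_sub (hP : ∀ i, 1 ≤ P i) (hq : q ∈ ctrs P)
    (c : ↥(Box d ℓ k (fun i => (ℓ + 1) * cubeM' Mh P q i))) (μ : Fin (d + 1)) :
    pos (emb ℓ k Mh P q hP hq c).1 μ - (((ℓ + 1) ^ k * ((ℓ + 1) * Mh) : ℕ) : ℝ) * q μ
      = pos c.1 μ - (((ℓ + 1) ^ k * ((ℓ + 1) * Mh) : ℕ) : ℝ) * locLabel q μ := by
  rw [pos_emb hP hq]
  simp only [locLabel]
  push_cast
  ring

/-- **THE ROW SUPPORT OF A TERM OF `R`**: if `(resᵀK_q(h_q)G′(□_q)h_q res·v)(x) ≠ 0` then `|x_μ + ½ − Nq_μ| < N` for every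
`μ` — the commutator row at `x` needs a site `x″` coupled to `x` by `E_q` (sup-distance `≤ nL`) with `h_q(x″) ≠ h_q(x)`,
hence `h_q ≠ 0` at `x` or `x″` (radius `⅝N`), and `nL ≤ ⅜N` for `M_h ≥ 3`.
[cite: Balaban1984PropagatorsII, (2.44) p.230, p.229 (cover of finite overlap)] -/
theorem abs_lt_of_bPad_ne_zero (hℓ : 1 ≤ ℓ) (hMh : 3 ≤ Mh) (hP : ∀ i, 1 ≤ P i) (aj a m2 : ℝ)
    {Λ : Finset ↥(boxDom (fun i => (ℓ + 1) * (Mh * P i)))} (hΛ : IsBlockUnion ℓ (fun i => Mh * P i) Λ)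
    (q : ↥(ctrs P)) (v : ↥(Box d ℓ k (fun i => (ℓ + 1) * (Mh * P i))) → ℝ)
    {x : ↥(Box d ℓ k (fun i => (ℓ + 1) * (Mh * P i)))} (hx : (bPad ℓ k Mh P aj a m2 Λ hP q *ᵥ v) x ≠ 0) (μ : Fin (d + 1)) :
    |pos x.1 μ - (((ℓ + 1) ^ k * ((ℓ + 1) * Mh) : ℕ) : ℝ) * q.1 μ| < (((ℓ + 1) ^ k * ((ℓ + 1) * Mh) : ℕ) : ℝ) := by
  have hn1 : 1 ≤ (ℓ + 1) ^ k := Nat.one_le_pow _ _ (by omega)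
  have hN1 : 1 ≤ (ℓ + 1) ^ k * ((ℓ + 1) * Mh) := Nat.one_le_iff_ne_zero.2 (by positivity)
  have hinj := emb_injective (ℓ := ℓ) (k := k) (Mh := Mh) hP q.2
  set N : ℕ := (ℓ + 1) ^ k * ((ℓ + 1) * Mh) with hNdef
  -- the site lies in the cube: `x = emb a`
  unfold bPad at hx
  rw [← Matrix.mulVec_mulVec, ← Matrix.mulVec_mulVec] at hx
  obtain ⟨y, rfl⟩ : ∃ y, emb ℓ k Mh P q.1 hP q.2 y = x := by
    by_contra hne
    push Not at hne
    exact hx (transpose_res_mulVec_off _ _ hne)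
  rw [transpose_res_mulVec_img hinj, ← Matrix.mulVec_mulVec, ← Matrix.mulVec_mulVec, kComm_mulVec] at hx
  obtain ⟨b, -, hb⟩ := Finset.exists_ne_zero_of_sum_ne_zero hx
  have hEyb : cubeOp ℓ k Mh P aj a m2 Λ hP q y b ≠ 0 := by
    intro h0; apply hb; rw [h0]; ring
  have hhyb : hLoc ℓ k Mh P q.1 y ≠ hLoc ℓ k Mh P q.1 b := by
    intro h0; apply hb; rw [h0]; ring
  have hdist : supNorm (y.1 - b.1) ≤ ((((ℓ + 1) ^ k : ℕ) : ℝ)) * ((ℓ : ℝ) + 1) :=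
    supNorm_le_of_twoLevelOp_ne_zero hn1 aj a m2 (isBlockUnion_lamLoc hP q.2 hΛ) hEyb
  -- `h_q ≠ 0` at `y` or at `b`
  have hc : ∃ c : ↥(Box d ℓ k (fun i => (ℓ + 1) * cubeM' Mh P q.1 i)),
      hLoc ℓ k Mh P q.1 c ≠ 0 ∧ supNorm (y.1 - c.1) ≤ ((((ℓ + 1) ^ k : ℕ) : ℝ)) * ((ℓ : ℝ) + 1) := by
    by_cases hy0 : hLoc ℓ k Mh P q.1 y = 0
    · exact ⟨b, fun hb0 => hhyb (by rw [hy0, hb0]), hdist⟩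
    · refine ⟨y, hy0, ?_⟩
      rw [sub_self, B4BoxCov237.supNorm_zero']; positivity
  obtain ⟨c, hc0, hyc⟩ := hc
  have hrad := abs_lt_of_hq_ne_zero hN1 hc0 μ
  rw [← pos_emb_sub hP q.2 c μ] at hrad
  -- `|pos(emb y) − pos(emb c)| = |y_μ − c_μ| ≤ nL ≤ ⅜N`
  have hdiff : |pos (emb ℓ k Mh P q.1 hP q.2 y).1 μ - pos (emb ℓ k Mh P q.1 hP q.2 c).1 μ|
      ≤ ((((ℓ + 1) ^ k : ℕ) : ℝ)) * ((ℓ : ℝ) + 1) := by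
    rw [pos_emb hP q.2, pos_emb hP q.2, add_sub_add_right_eq_sub]
    have h1 := abs_le_supNorm (y.1 - c.1) μ
    rw [Pi.sub_apply] at h1
    push_cast at h1
    have e : pos y.1 μ - pos c.1 μ = ((y.1 μ : ℤ) : ℝ) - ((c.1 μ : ℤ) : ℝ) := by simp only [pos]; ring
    rw [e]
    exact h1.trans hyc
  have hNL : ((((ℓ + 1) ^ k : ℕ) : ℝ)) * ((ℓ : ℝ) + 1) ≤ 3 / 8 * (N : ℝ) := by
    rw [hNdef]; push_cast
    have hMh' : (3 : ℝ) ≤ Mh := by exact_mod_cast hMh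
    have h0 : (0 : ℝ) ≤ (((ℓ : ℝ) + 1) ^ k) * ((ℓ : ℝ) + 1) := by positivity
    nlinarith
  calc |pos (emb ℓ k Mh P q.1 hP q.2 y).1 μ - (N : ℝ) * q.1 μ|
      = |(pos (emb ℓ k Mh P q.1 hP q.2 y).1 μ - pos (emb ℓ k Mh P q.1 hP q.2 c).1 μ)
          + (pos (emb ℓ k Mh P q.1 hP q.2 c).1 μ - (N : ℝ) * q.1 μ)| := by ring_nf
    _ ≤ |pos (emb ℓ k Mh P q.1 hP q.2 y).1 μ - pos (emb ℓ k Mh P q.1 hP q.2 c).1 μ|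
          + |pos (emb ℓ k Mh P q.1 hP q.2 c).1 μ - (N : ℝ) * q.1 μ| := abs_add_le _ _
    _ < 3 / 8 * (N : ℝ) + 5 / 8 * (N : ℝ) := add_lt_add_of_le_of_lt (hdiff.trans hNL) hrad
    _ = N := by ring

/-- **THE ROW SUPPORT OF A TERM OF `G′₀`**: if `(h_qG′(□_q)h_q·v)(x) ≠ 0` then `h_q(x) ≠ 0`, so `|x_μ + ½ − Nq_μ| < ⅝N < N`.
[cite: Balaban1984PropagatorsII, (2.36)–(2.37) p.229] -/
theorem abs_lt_of_aPad_ne_zero (hMh : 1 ≤ Mh) (hP : ∀ i, 1 ≤ P i) (aj a m2 : ℝ)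
    (Λ : Finset ↥(boxDom (fun i => (ℓ + 1) * (Mh * P i)))) (q : ↥(ctrs P))
    (v : ↥(Box d ℓ k (fun i => (ℓ + 1) * (Mh * P i))) → ℝ) {x : ↥(Box d ℓ k (fun i => (ℓ + 1) * (Mh * P i)))}
    (hx : ((hDiag ℓ k Mh P q * gPad ℓ k Mh P aj a m2 Λ hP q * hDiag ℓ k Mh P q) *ᵥ v) x ≠ 0) (μ : Fin (d + 1)) :
    |pos x.1 μ - (((ℓ + 1) ^ k * ((ℓ + 1) * Mh) : ℕ) : ℝ) * q.1 μ| < (((ℓ + 1) ^ k * ((ℓ + 1) * Mh) : ℕ) : ℝ) := by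
  have hN1 : 1 ≤ (ℓ + 1) ^ k * ((ℓ + 1) * Mh) := Nat.one_le_iff_ne_zero.2 (by positivity)
  have hNr : (0 : ℝ) < (((ℓ + 1) ^ k * ((ℓ + 1) * Mh) : ℕ) : ℝ) := by exact_mod_cast hN1
  unfold hDiag at hx
  rw [Matrix.mul_assoc, ← Matrix.mulVec_mulVec, Matrix.mulVec_diagonal] at hx
  have h0 : hΩ ℓ k Mh P q.1 x ≠ 0 := fun h => hx (by rw [h, zero_mul])
  exact (abs_lt_of_hq_ne_zero hN1 h0 μ).trans (by nlinarith)

end Support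

/-! ## §3 (2.49) `‖R‖ ≤ O(M^{−1})` and `‖G′₀‖ ≤ O(1)`, uniformly in the mesh and the volume -/

section Ineq249

variable {ℓ k Mh : ℕ} {P : Fin (d + 1) → ℕ}

/-- the value of a padded cube operator at a site of `Ω` is a local value on the cube, or `0` outside: a uniform
bound of the local values bounds it. [cite: Balaban1983RegularityDecay, §2 p.575, dictionary] -/
theorem pad_mulVec_apply_le (hP : ∀ i, 1 ≤ P i) {q : Fin (d + 1) → ℤ} (hq : q ∈ ctrs P)
    (T : Matrix ↥(Box d ℓ k (fun i => (ℓ + 1) * cubeM' Mh P q i)) ↥(Box d ℓ k (fun i => (ℓ + 1) * cubeM' Mh P q i)) ℝ)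
    (v : ↥(Box d ℓ k (fun i => (ℓ + 1) * (Mh * P i))) → ℝ) (x : ↥(Box d ℓ k (fun i => (ℓ + 1) * (Mh * P i))))
    {B : ℝ} (hB : 0 ≤ B) (h : ∀ z, |(T *ᵥ (res (emb ℓ k Mh P q hP hq) *ᵥ v)) z| ≤ B) :
    |(((res (emb ℓ k Mh P q hP hq))ᵀ * T * res (emb ℓ k Mh P q hP hq)) *ᵥ v) x| ≤ B := by
  have hinj := emb_injective (ℓ := ℓ) (k := k) (Mh := Mh) hP hq
  rw [← Matrix.mulVec_mulVec, ← Matrix.mulVec_mulVec]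
  by_cases hx : ∃ z, emb ℓ k Mh P q hP hq z = x
  · obtain ⟨z, rfl⟩ := hx
    rw [transpose_res_mulVec_img hinj]
    exact h z
  · push Not at hx
    rw [transpose_res_mulVec_off _ _ hx, abs_zero]
    exact hB

/-- **[B6] (2.49) FOR THE GENUINE TWO-LEVEL OPERATOR ON A BOX**: there is `C′ = C′(d, ℓ, window) > 0` such that
`‖R‖_{∞→∞} ≤ C′/M` (`M = L·M_h` the cube half-width in unit blocks) for EVERY `k ≥ 1` (mesh `L^{−k}`), `M_h ≥ 3`, volume
`P`, block union `Λ` and window point — from (2.44) per cube (`B6Ineq243TwoLevelBox.ineq244_twoLevel` with the sizes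
`κ₁ = (d+1)sup|h′|/M`, `κ₂ = (d+1)sup|h″|/M²` of the printed cut-off, `B6Partition236TwoLevelBox.abs_hq_sub_le`/`hloc_laplacian`)
and the finite overlap of the cover (`≤ 2^{d+1}` cubes per row). [cite: Balaban1984PropagatorsII, (2.49) p.232] -/
theorem norm_rOp_le (d ℓ : ℕ) (hℓ : 1 ≤ ℓ) (aminus aplus m2plus a2minus a2plus : ℝ) (ha : 0 < aminus)
    (ha2 : 0 < a2minus) :
    ∃ C' : ℝ, 0 < C' ∧ ∀ (k : ℕ), 1 ≤ k → ∀ (aj m2 a : ℝ), aminus ≤ aj → aj ≤ aplus → 0 ≤ m2 → m2 ≤ m2plus →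
      a2minus ≤ a → a ≤ a2plus → ∀ (Mh : ℕ), 3 ≤ Mh → ∀ (P : Fin (d + 1) → ℕ) (hP : ∀ i, 1 ≤ P i)
        (Λ : Finset ↥(boxDom (fun i => (ℓ + 1) * (Mh * P i)))), IsBlockUnion ℓ (fun i => Mh * P i) Λ →
        ‖B6Eq250.rOp (twoLevelOp ((ℓ + 1) ^ k) ℓ aj a m2 (fun i => Mh * P i) Λ) (hDiag ℓ k Mh P)
            (gPad ℓ k Mh P aj a m2 Λ hP)‖ ≤ C' / (((ℓ : ℝ) + 1) * Mh) := by
  obtain ⟨δ', C, hδ', hC, h244⟩ := ineq244_twoLevel d ℓ hℓ aminus aplus m2plus a2minus a2plus ha ha2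
  have hD1 := D1_nonneg contDiff_hprof hasCompactSupport_hprof
  have hD2 := D2_nonneg contDiff_hprof hasCompactSupport_hprof
  refine ⟨2 ^ (d + 1) * C * ((d + 1) * (D1 hprof + D2 hprof)) + 1, by positivity, ?_⟩
  intro k hk aj m2 a e1 e2 e3 e4 e5 e6 Mh hMh P hP Λ hΛ
  have hMh1 : 1 ≤ Mh := le_trans (by norm_num) hMh
  have hn1 : 1 ≤ (ℓ + 1) ^ k := Nat.one_le_pow _ _ (by omega)
  have hN1 : 1 ≤ (ℓ + 1) ^ k * ((ℓ + 1) * Mh) := Nat.one_le_iff_ne_zero.2 (by positivity)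
  have hN4 : 4 ≤ (ℓ + 1) ^ k * ((ℓ + 1) * Mh) := four_le_N hℓ hk hMh1
  set M : ℝ := ((ℓ : ℝ) + 1) * Mh with hMdef
  have hM1 : (1 : ℝ) ≤ M := by
    have : (1 : ℝ) ≤ Mh := by exact_mod_cast hMh1
    have : (1 : ℝ) ≤ (ℓ : ℝ) + 1 := by linarith [(Nat.cast_nonneg ℓ : (0 : ℝ) ≤ ℓ)]
    rw [hMdef]; nlinarith
  have hMpos : 0 < M := by linarith
  set κ₁ : ℝ := (d + 1) * D1 hprof / M with hκ₁
  set κ₂ : ℝ := (d + 1) * (D2 hprof / M ^ 2) with hκ₂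
  have hκ₁0 : 0 ≤ κ₁ := by positivity
  -- the pointwise bound of each cube term
  have hterm : ∀ (q : ↥(ctrs P)) (v : ↥(Box d ℓ k (fun i => (ℓ + 1) * (Mh * P i))) → ℝ)
      (x : ↥(Box d ℓ k (fun i => (ℓ + 1) * (Mh * P i)))),
      |(bPad ℓ k Mh P aj a m2 Λ hP q *ᵥ v) x| ≤ C * (κ₁ + κ₂) * ‖v‖ := by
    intro q v x
    have hM' : ∀ i, 1 ≤ cubeM' Mh P q.1 i := fun i =>
      Nat.one_le_iff_ne_zero.2 (Nat.mul_ne_zero_iff.2 ⟨by omega, by have := (one_le_cubeW hP q.2 i).1; omega⟩)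
    unfold bPad
    refine pad_mulVec_apply_le hP q.2 _ v x (by positivity) fun z => ?_
    rw [← Matrix.mulVec_mulVec, ← Matrix.mulVec_mulVec]
    -- (2.44) on the cube with `g = h_q·(v ∘ emb)`, `F = ‖v‖`, `D = 0`
    have hLip : ∀ z z' : ↥(Box d ℓ k (fun i => (ℓ + 1) * cubeM' Mh P q.1 i)),
        |hLoc ℓ k Mh P q.1 z' - hLoc ℓ k Mh P q.1 z| ≤ κ₁ * supNorm (z'.1 - z.1) / (((ℓ + 1) ^ k : ℕ) : ℝ) := by
      intro z z'
      have := abs_hq_sub_le (d := d) hn1 (Nat.one_le_iff_ne_zero.2 (by positivity : (ℓ + 1) * Mh ≠ 0))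
        (locLabel q.1) z.1 z'.1
      rw [hκ₁, hMdef]
      push_cast at this ⊢
      exact this
    have hLap : ∀ z : ↥(Box d ℓ k (fun i => (ℓ + 1) * cubeM' Mh P q.1 i)),
        |((((ℓ + 1) ^ k : ℕ) : ℝ)) ^ 2 * ∑ z' ∈ boxNbrs _ z, (hLoc ℓ k Mh P q.1 z' - hLoc ℓ k Mh P q.1 z)| ≤ κ₂ := by
      intro z
      obtain hcw := fun i => cubeW_cases hP q.2 i
      have hl := hloc_laplacian (d := d) (n := (ℓ + 1) ^ k) (M := (ℓ + 1) * Mh) hN4 (c := locLabel q.1)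
        (w := fun i => cubeW P q.1 i) (S := fun i => (ℓ + 1) ^ k * ((ℓ + 1) * cubeM' Mh P q.1 i))
        (fun i => by simp only [cubeM']; ring) (fun i => (hcw i).1) (fun i => (hcw i).2) z
      rw [abs_mul, abs_of_nonneg (by positivity)]
      have hNsq : ((((ℓ + 1) ^ k : ℕ) : ℝ)) ^ 2 * ((d + 1) * (D2 hprof / ((((ℓ + 1) ^ k * ((ℓ + 1) * Mh) : ℕ) : ℝ)) ^ 2))
          = κ₂ := by
        rw [hκ₂, hMdef]; push_cast
        have : (((ℓ : ℝ) + 1) ^ k) ≠ 0 := by positivity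
        field_simp
      calc ((((ℓ + 1) ^ k : ℕ) : ℝ)) ^ 2 * |∑ z' ∈ boxNbrs _ z, (hLoc ℓ k Mh P q.1 z' - hLoc ℓ k Mh P q.1 z)|
          ≤ ((((ℓ + 1) ^ k : ℕ) : ℝ)) ^ 2 * ((d + 1) * (D2 hprof / ((((ℓ + 1) ^ k * ((ℓ + 1) * Mh) : ℕ) : ℝ)) ^ 2)) :=
            mul_le_mul_of_nonneg_left hl (by positivity)
        _ = κ₂ := hNsq
    have hg : ∀ z', |(Matrix.diagonal (hLoc ℓ k Mh P q.1) *ᵥ (res (emb ℓ k Mh P q.1 hP q.2) *ᵥ v)) z'| ≤ ‖v‖ := by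
      intro z'
      rw [Matrix.mulVec_diagonal, res_mulVec, abs_mul]
      calc |hLoc ℓ k Mh P q.1 z'| * |v (emb ℓ k Mh P q.1 hP q.2 z')| ≤ 1 * ‖v‖ :=
            mul_le_mul (abs_hq_le_one _ _ _ _) (abs_apply_le_norm v _) (abs_nonneg _) zero_le_one
        _ = ‖v‖ := one_mul _
    have h := h244 k hk aj m2 a e1 e2 e3 e4 e5 e6 (cubeM' Mh P q.1) hM' (lamLoc ℓ Mh P q.1 hP q.2 Λ)
      (isBlockUnion_lamLoc hP q.2 hΛ) (hLoc ℓ k Mh P q.1) κ₁ κ₂ hκ₁0 hLip hLap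
      (Matrix.diagonal (hLoc ℓ k Mh P q.1) *ᵥ (res (emb ℓ k Mh P q.1 hP q.2) *ᵥ v)) ‖v‖ 0 hg z
      (fun x' _ => supNorm_nonneg _)
    rw [mul_zero, zero_div, neg_zero, Real.exp_zero, mul_one] at h
    exact h
  -- assembling the rows: at most `2^{d+1}` non-zero terms, each `≤ C(κ₁+κ₂)‖v‖`
  have hsum : ∀ (v : ↥(Box d ℓ k (fun i => (ℓ + 1) * (Mh * P i))) → ℝ)
      (x : ↥(Box d ℓ k (fun i => (ℓ + 1) * (Mh * P i)))),
      |(B6Eq250.rOp (twoLevelOp ((ℓ + 1) ^ k) ℓ aj a m2 (fun i => Mh * P i) Λ) (hDiag ℓ k Mh P)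
          (gPad ℓ k Mh P aj a m2 Λ hP) *ᵥ v) x| ≤ 2 ^ (d + 1) * (C * (κ₁ + κ₂)) * ‖v‖ := by
    intro v x
    rw [B6Eq250.rOp_eq_sum_bTerm, Matrix.sum_mulVec, Finset.sum_apply]
    refine (Finset.abs_sum_le_sum_abs _ _).trans ?_
    have hb : ∀ q : ↥(ctrs P), B6Eq250.bTerm (twoLevelOp ((ℓ + 1) ^ k) ℓ aj a m2 (fun i => Mh * P i) Λ)
        (hDiag ℓ k Mh P) (gPad ℓ k Mh P aj a m2 Λ hP) q = bPad ℓ k Mh P aj a m2 Λ hP q := fun q => by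
      rw [B6Eq250.bTerm_apply]; exact bTerm_eq_bPad hℓ hk hMh1 hΛ q
    simp_rw [hb]
    have key := sum_le_card_mul (fun q : ↥(ctrs P) => |(bPad ℓ k Mh P aj a m2 Λ hP q *ᵥ v) x|)
      (fun q => q.1) Subtype.val_injective (near ((ℓ + 1) ^ k * ((ℓ + 1) * Mh)) x.1)
      (fun q hq0 => mem_near_of_abs_lt hN1 (abs_lt_of_bPad_ne_zero hℓ hMh hP aj a m2 hΛ q v
        (fun h0 => hq0 (by rw [h0, abs_zero]))))
      (by positivity : 0 ≤ C * (κ₁ + κ₂) * ‖v‖) (fun q => hterm q v x)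
    refine key.trans ?_
    have hcard : ((near ((ℓ + 1) ^ k * ((ℓ + 1) * Mh)) x.1).card : ℝ) ≤ 2 ^ (d + 1) := by
      exact_mod_cast card_near_le _ _
    have : 0 ≤ C * (κ₁ + κ₂) * ‖v‖ := by positivity
    nlinarith
  refine (linfty_opNorm_le_of_pointwise _ (by positivity) hsum).trans ?_
  -- `2^{d+1}C(κ₁ + κ₂) ≤ C′/M`
  have hκ : κ₁ + κ₂ ≤ (d + 1) * (D1 hprof + D2 hprof) / M := by
    rw [hκ₁, hκ₂]
    have hM2 : D2 hprof / M ^ 2 ≤ D2 hprof / M := by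
      apply div_le_div_of_nonneg_left hD2 hMpos
      nlinarith
    have : (d + 1) * (D2 hprof / M ^ 2) ≤ (d + 1) * (D2 hprof / M) := mul_le_mul_of_nonneg_left hM2 (by positivity)
    calc (d + 1) * D1 hprof / M + (d + 1) * (D2 hprof / M ^ 2)
        ≤ (d + 1) * D1 hprof / M + (d + 1) * (D2 hprof / M) := by linarith
      _ = (d + 1) * (D1 hprof + D2 hprof) / M := by field_simp
  calc 2 ^ (d + 1) * (C * (κ₁ + κ₂)) ≤ 2 ^ (d + 1) * (C * ((d + 1) * (D1 hprof + D2 hprof) / M)) := by gcongr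
    _ = (2 ^ (d + 1) * C * ((d + 1) * (D1 hprof + D2 hprof))) / M := by ring
    _ ≤ (2 ^ (d + 1) * C * ((d + 1) * (D1 hprof + D2 hprof)) + 1) / M := by gcongr; linarith

/-- **`‖G′₀‖_{∞→∞} ≤ 2^{d+1}c′`**, uniformly: each `h_qG′(□_q)h_q` has rows bounded by the uniform row sum `c′` of
`G′(□_q)` ((2.43)₁, `B6Ineq243TwoLevelBox.ineq243_twoLevel_rowSum_colSum`) and at most `2^{d+1}` of them meet a row.
[cite: Balaban1984PropagatorsII, (2.37) p.229, (2.43) p.230] -/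
theorem norm_gZero_le (d ℓ : ℕ) (hℓ : 1 ≤ ℓ) (aminus aplus m2plus a2minus a2plus : ℝ) (ha : 0 < aminus)
    (ha2 : 0 < a2minus) :
    ∃ c' : ℝ, 0 < c' ∧ ∀ (k : ℕ), 1 ≤ k → ∀ (aj m2 a : ℝ), aminus ≤ aj → aj ≤ aplus → 0 ≤ m2 → m2 ≤ m2plus →
      a2minus ≤ a → a ≤ a2plus → ∀ (Mh : ℕ), 1 ≤ Mh → ∀ (P : Fin (d + 1) → ℕ) (hP : ∀ i, 1 ≤ P i)
        (Λ : Finset ↥(boxDom (fun i => (ℓ + 1) * (Mh * P i)))),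
        ‖B6Eq250.gZero (hDiag ℓ k Mh P) (gPad ℓ k Mh P aj a m2 Λ hP)‖ ≤ 2 ^ (d + 1) * c' := by
  obtain ⟨c', hc', h243⟩ := ineq243_twoLevel_rowSum_colSum d ℓ hℓ aminus aplus m2plus a2minus a2plus ha ha2
  refine ⟨c', hc', ?_⟩
  intro k hk aj m2 a e1 e2 e3 e4 e5 e6 Mh hMh P hP Λ
  have hN1 : 1 ≤ (ℓ + 1) ^ k * ((ℓ + 1) * Mh) := Nat.one_le_iff_ne_zero.2 (by positivity)
  refine linfty_opNorm_le_of_pointwise _ (by positivity) fun v x => ?_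
  rw [B6Eq250.gZero_eq_sum_aTerm, Matrix.sum_mulVec, Finset.sum_apply]
  refine (Finset.abs_sum_le_sum_abs _ _).trans ?_
  simp_rw [B6Eq250.aTerm_apply]
  have hterm : ∀ q : ↥(ctrs P),
      |((hDiag ℓ k Mh P q * gPad ℓ k Mh P aj a m2 Λ hP q * hDiag ℓ k Mh P q) *ᵥ v) x| ≤ c' * ‖v‖ := by
    intro q
    have hM' : ∀ i, 1 ≤ cubeM' Mh P q.1 i := fun i =>
      Nat.one_le_iff_ne_zero.2 (Nat.mul_ne_zero_iff.2 ⟨by omega, by have := (one_le_cubeW hP q.2 i).1; omega⟩)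
    have e : ((hDiag ℓ k Mh P q * gPad ℓ k Mh P aj a m2 Λ hP q * hDiag ℓ k Mh P q) *ᵥ v) x
        = hΩ ℓ k Mh P q.1 x * (gPad ℓ k Mh P aj a m2 Λ hP q *ᵥ (Matrix.diagonal (hΩ ℓ k Mh P q.1) *ᵥ v)) x := by
      unfold hDiag
      rw [Matrix.mul_assoc, ← Matrix.mulVec_mulVec, Matrix.mulVec_diagonal, ← Matrix.mulVec_mulVec]
    rw [e, abs_mul]
    calc |hΩ ℓ k Mh P q.1 x| * |(gPad ℓ k Mh P aj a m2 Λ hP q *ᵥ (Matrix.diagonal (hΩ ℓ k Mh P q.1) *ᵥ v)) x|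
        ≤ 1 * (c' * ‖v‖) := by
          refine mul_le_mul (abs_hq_le_one _ _ _ _) ?_ (abs_nonneg _) zero_le_one
          unfold gPad
          refine pad_mulVec_apply_le hP q.2 _ _ x (by positivity) fun z => ?_
          -- a row of `G′(□_q)` against a vector bounded by `‖v‖`
          have hw : ∀ j, |(res (emb ℓ k Mh P q.1 hP q.2) *ᵥ (Matrix.diagonal (hΩ ℓ k Mh P q.1) *ᵥ v)) j| ≤ ‖v‖ := by
            intro j
            rw [res_mulVec, Matrix.mulVec_diagonal, abs_mul]
            calc |hΩ ℓ k Mh P q.1 _| * |v _| ≤ 1 * ‖v‖ :=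
                  mul_le_mul (abs_hq_le_one _ _ _ _) (abs_apply_le_norm v _) (abs_nonneg _) zero_le_one
              _ = ‖v‖ := one_mul _
          refine (abs_mulVec_le_rowSum_mul _ _ z hw).trans ?_
          exact mul_le_mul_of_nonneg_right
            (h243 k hk aj m2 a e1 e2 e3 e4 e5 e6 (cubeM' Mh P q.1) hM' (lamLoc ℓ Mh P q.1 hP q.2 Λ) z).1 (norm_nonneg _)
      _ = c' * ‖v‖ := one_mul _
  have key := sum_le_card_mul
    (fun q : ↥(ctrs P) => |((hDiag ℓ k Mh P q * gPad ℓ k Mh P aj a m2 Λ hP q * hDiag ℓ k Mh P q) *ᵥ v) x|)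
    (fun q => q.1) Subtype.val_injective (near ((ℓ + 1) ^ k * ((ℓ + 1) * Mh)) x.1)
    (fun q hq0 => mem_near_of_abs_lt hN1 (abs_lt_of_aPad_ne_zero hMh hP aj a m2 Λ q v
      (fun h0 => hq0 (by rw [h0, abs_zero]))))
    (by positivity : 0 ≤ c' * ‖v‖) hterm
  refine key.trans ?_
  have hcard : ((near ((ℓ + 1) ^ k * ((ℓ + 1) * Mh)) x.1).card : ℝ) ≤ 2 ^ (d + 1) := by
    exact_mod_cast card_near_le _ _
  have : 0 ≤ c' * ‖v‖ := by positivity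
  nlinarith

end Ineq249

/-! ## §4 (2.50): the parametrix series converges to the propagator of the box -/

section Eq250

variable {ℓ k Mh : ℕ} {P : Fin (d + 1) → ℕ}

/-- **[B6] (2.49) ⇒ «R has a small norm … for M sufficiently large», (2.50) AND THE IDENTIFICATION `G′ = (Δ_Ω + Q′*aQ′)^{−1}`,
FOR THE GENUINE TWO-LEVEL OPERATOR ON A BOX**: there are `M₀, C″ > 0` (depending on `d`, `ℓ` and the window) such that
for EVERY `k ≥ 1`, `M_h` with `L·M_h ≥ M₀` and `M_h ≥ 3`, volume `P`, block union `Λ` and window point: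
`‖R‖ ≤ ½`; the Neumann series `G′₀Σ'_nRⁿ` is a right inverse of `E = Δ_Ω^{L^{−j},N} + m² + Q′*aQ′↾_Ω`; it EQUALS the box
propagator `gTwoLevel` of `B6Ineq243TwoLevelBox`; `Σ_n G′₀Rⁿ` CONVERGES to it in the `ℓ^∞` operator norm («The expansion
(2.50) is convergent in the L^∞ operator norm»); and `‖(Δ_Ω + Q′*aQ′)^{−1}‖_{∞→∞} ≤ C″` uniformly.
[cite: Balaban1984PropagatorsII, (2.49)–(2.50) p.232; Proposition 2.2 (last sentence) p.234] -/
theorem eq250_twoLevelBox (d ℓ : ℕ) (hℓ : 1 ≤ ℓ) (aminus aplus m2plus a2minus a2plus : ℝ) (ha : 0 < aminus)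
    (ha2 : 0 < a2minus) :
    ∃ M₀ C'' : ℝ, 0 < M₀ ∧ 0 < C'' ∧ ∀ (k : ℕ), 1 ≤ k → ∀ (aj m2 a : ℝ), aminus ≤ aj → aj ≤ aplus → 0 ≤ m2 →
      m2 ≤ m2plus → a2minus ≤ a → a ≤ a2plus → ∀ (Mh : ℕ), 3 ≤ Mh → M₀ ≤ ((ℓ : ℝ) + 1) * Mh →
        ∀ (P : Fin (d + 1) → ℕ) (hP : ∀ i, 1 ≤ P i) (Λ : Finset ↥(boxDom (fun i => (ℓ + 1) * (Mh * P i)))),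
        IsBlockUnion ℓ (fun i => Mh * P i) Λ →
        let E := twoLevelOp ((ℓ + 1) ^ k) ℓ aj a m2 (fun i => Mh * P i) Λ
        let R := B6Eq250.rOp E (hDiag ℓ k Mh P) (gPad ℓ k Mh P aj a m2 Λ hP)
        let G₀ := B6Eq250.gZero (hDiag ℓ k Mh P) (gPad ℓ k Mh P aj a m2 Λ hP)
        ‖R‖ ≤ 1 / 2
          ∧ E * (G₀ * ∑' n : ℕ, R ^ n) = 1
          ∧ gTwoLevel ((ℓ + 1) ^ k) ℓ aj a m2 (fun i => Mh * P i) Λ = G₀ * ∑' n : ℕ, R ^ n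
          ∧ HasSum (fun n : ℕ => G₀ * R ^ n) (gTwoLevel ((ℓ + 1) ^ k) ℓ aj a m2 (fun i => Mh * P i) Λ)
          ∧ ‖gTwoLevel ((ℓ + 1) ^ k) ℓ aj a m2 (fun i => Mh * P i) Λ‖ ≤ C'' := by
  obtain ⟨C', hC', h249⟩ := norm_rOp_le d ℓ hℓ aminus aplus m2plus a2minus a2plus ha ha2
  obtain ⟨c', hc', h0⟩ := norm_gZero_le d ℓ hℓ aminus aplus m2plus a2minus a2plus ha ha2
  refine ⟨2 * C', 2 * (2 ^ (d + 1) * c'), by positivity, by positivity, ?_⟩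
  intro k hk aj m2 a e1 e2 e3 e4 e5 e6 Mh hMh hM P hP Λ hΛ E R G₀
  have hMh1 : 1 ≤ Mh := le_trans (by norm_num) hMh
  have hn1 : 1 ≤ (ℓ + 1) ^ k := Nat.one_le_pow _ _ (by omega)
  haveI : CompleteSpace (Matrix ↥(Box d ℓ k (fun i => (ℓ + 1) * (Mh * P i))) ↥(Box d ℓ k (fun i => (ℓ + 1) * (Mh * P i))) ℝ) :=
    FiniteDimensional.complete ℝ _
  have hMpos : (0 : ℝ) < ((ℓ : ℝ) + 1) * Mh := by
    have : (1 : ℝ) ≤ Mh := by exact_mod_cast hMh1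
    have : (0 : ℝ) ≤ ℓ := Nat.cast_nonneg ℓ
    positivity
  -- (2.49) and the smallness
  have hR : ‖R‖ ≤ 1 / 2 := by
    have h := h249 k hk aj m2 a e1 e2 e3 e4 e5 e6 Mh hMh P hP Λ hΛ
    calc ‖R‖ ≤ C' / (((ℓ : ℝ) + 1) * Mh) := h
      _ ≤ C' / (2 * C') := div_le_div_of_nonneg_left hC'.le (by positivity) hM
      _ = 1 / 2 := by field_simp
  have hR1 : ‖R‖ < 1 := by linarith
  -- the two printed hypotheses of `B6Eq250`, discharged in `B6Eq238TwoLevelBox`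
  have hpart := sum_hDiag_sq (ℓ := ℓ) (k := k) (P := P) hMh1
  have hloc := hloc_cube (k := k) (hP := hP) hℓ hk hMh1 (lt_of_lt_of_le ha e1) (lt_of_lt_of_le ha2 e5) e3 hΛ
  have hGD : gTwoLevel ((ℓ + 1) ^ k) ℓ aj a m2 (fun i => Mh * P i) Λ * E = 1 :=
    gTwoLevel_mul_twoLevelOp hn1 hℓ (lt_of_lt_of_le ha e1) (lt_of_lt_of_le ha2 e5) e3
      (fun i => Nat.one_le_iff_ne_zero.2 (Nat.mul_ne_zero_iff.2 ⟨by omega, by have := hP i; omega⟩)) hΛ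
  refine ⟨hR, B6Eq250.series_right_inverse E _ _ hpart hloc hR1,
    B6Eq250.left_inverse_eq_series E _ _ _ hGD hpart hloc hR1, B6Eq250.neumann250 E _ _ _ hGD hpart hloc hR1, ?_⟩
  -- the uniform bound: `‖G′‖ ≤ ‖G′₀‖·‖Σ'Rⁿ‖ ≤ 2^{d+1}c′·2`
  rw [B6Eq250.left_inverse_eq_series E _ _ _ hGD hpart hloc hR1]
  have hG0 := h0 k hk aj m2 a e1 e2 e3 e4 e5 e6 Mh hMh1 P hP Λ
  have hS : ‖∑' n : ℕ, R ^ n‖ ≤ 2 := by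
    have h1 := tsum_geometric_le_of_norm_lt_one R hR1
    have h2 : (1 - ‖R‖)⁻¹ ≤ 2 := by
      rw [inv_le_comm₀ (by linarith) (by norm_num)]; linarith
    have h3 : ‖(1 : Matrix ↥(boxDom (fun i => (ℓ + 1) ^ k * ((ℓ + 1) * (Mh * P i))))
        ↥(boxDom (fun i => (ℓ + 1) ^ k * ((ℓ + 1) * (Mh * P i)))) ℝ)‖ ≤ 1 := linfty_opNorm_one_le
    have h4 := le_trans h1 (add_le_add (sub_le_sub_right h3 1) h2)
    norm_num at h4
    exact h4
  calc ‖G₀ * ∑' n : ℕ, R ^ n‖ ≤ ‖G₀‖ * ‖∑' n : ℕ, R ^ n‖ := norm_mul_le _ _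
    _ ≤ 2 ^ (d + 1) * c' * 2 := mul_le_mul hG0 hS (norm_nonneg _) (by positivity)
    _ = 2 * (2 ^ (d + 1) * c') := by ring

end Eq250

/-! ## §5 (v1.1) (2.51): the decaying form of (2.49) -/

section Ineq251

variable {ℓ k Mh : ℕ} {P : Fin (d + 1) → ℕ}

/-- embedded sites differ by their local difference. [cite: Balaban1983RegularityDecay, §2 p.575, dictionary] -/
theorem emb_sub_emb (hP : ∀ i, 1 ≤ P i) {q : Fin (d + 1) → ℤ} (hq : q ∈ ctrs P)
    (z b : ↥(Box d ℓ k (fun i => (ℓ + 1) * cubeM' Mh P q i))) :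
    (emb ℓ k Mh P q hP hq z).1 - (emb ℓ k Mh P q hP hq b).1 = z.1 - b.1 := by
  rw [emb_val' hP hq, emb_val' hP hq]; abel

/-- **[B6] (2.51) FOR THE GENUINE TWO-LEVEL OPERATOR ON A BOX** («From (2.44) and (2.38) we have
|(Rλ)(x)| ≤ O(M^{−1})e^{−δ₀d(x,y)}|λ| if supp λ ⊂ B^j(y)»), in the support-distance form of gen-7's (2.44): there are
`δ′, C′ > 0` (functions of `d`, `ℓ`, window) with `|(Rλ)(x)| ≤ (C′/M)·e^{−δ′D/n}·F` whenever `|λ| ≤ F` and every site of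
`supp λ` is at sup-distance `≥ D` (fine units; `D/n` = the distance on the `L^{−j}`-scale) from `x` — for EVERY `k ≥ 1`,
`M_h ≥ 3`, volume, block union and window point. [cite: Balaban1984PropagatorsII, (2.51) p.232] -/
theorem ineq251_twoLevelBox (d ℓ : ℕ) (hℓ : 1 ≤ ℓ) (aminus aplus m2plus a2minus a2plus : ℝ) (ha : 0 < aminus)
    (ha2 : 0 < a2minus) :
    ∃ δ' C' : ℝ, 0 < δ' ∧ 0 < C' ∧ ∀ (k : ℕ), 1 ≤ k → ∀ (aj m2 a : ℝ), aminus ≤ aj → aj ≤ aplus → 0 ≤ m2 →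
      m2 ≤ m2plus → a2minus ≤ a → a ≤ a2plus → ∀ (Mh : ℕ), 3 ≤ Mh → ∀ (P : Fin (d + 1) → ℕ) (hP : ∀ i, 1 ≤ P i)
        (Λ : Finset ↥(boxDom (fun i => (ℓ + 1) * (Mh * P i)))), IsBlockUnion ℓ (fun i => Mh * P i) Λ →
        ∀ (g : ↥(Box d ℓ k (fun i => (ℓ + 1) * (Mh * P i))) → ℝ) (F Dd : ℝ), (∀ x', |g x'| ≤ F) →
        ∀ x : ↥(Box d ℓ k (fun i => (ℓ + 1) * (Mh * P i))), (∀ x', g x' ≠ 0 → Dd ≤ supNorm (x.1 - x'.1)) →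
          |(B6Eq250.rOp (twoLevelOp ((ℓ + 1) ^ k) ℓ aj a m2 (fun i => Mh * P i) Λ) (hDiag ℓ k Mh P)
              (gPad ℓ k Mh P aj a m2 Λ hP) *ᵥ g) x|
            ≤ C' / (((ℓ : ℝ) + 1) * Mh) * Real.exp (-(δ' * Dd / (((ℓ + 1) ^ k : ℕ) : ℝ))) * F := by
  obtain ⟨δ', C, hδ', hC, h244⟩ := ineq244_twoLevel d ℓ hℓ aminus aplus m2plus a2minus a2plus ha ha2
  have hD1 := D1_nonneg contDiff_hprof hasCompactSupport_hprof
  have hD2 := D2_nonneg contDiff_hprof hasCompactSupport_hprof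
  refine ⟨δ', 2 ^ (d + 1) * C * ((d + 1) * (D1 hprof + D2 hprof)) + 1, hδ', by positivity, ?_⟩
  intro k hk aj m2 a e1 e2 e3 e4 e5 e6 Mh hMh P hP Λ hΛ g F Dd hg x hD
  have hMh1 : 1 ≤ Mh := le_trans (by norm_num) hMh
  have hn1 : 1 ≤ (ℓ + 1) ^ k := Nat.one_le_pow _ _ (by omega)
  have hN1 : 1 ≤ (ℓ + 1) ^ k * ((ℓ + 1) * Mh) := Nat.one_le_iff_ne_zero.2 (by positivity)
  have hN4 : 4 ≤ (ℓ + 1) ^ k * ((ℓ + 1) * Mh) := four_le_N hℓ hk hMh1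
  have hF : 0 ≤ F := le_trans (abs_nonneg _) (hg x)
  set M : ℝ := ((ℓ : ℝ) + 1) * Mh with hMdef
  have hM1 : (1 : ℝ) ≤ M := by
    have : (1 : ℝ) ≤ Mh := by exact_mod_cast hMh1
    have : (1 : ℝ) ≤ (ℓ : ℝ) + 1 := by linarith [(Nat.cast_nonneg ℓ : (0 : ℝ) ≤ ℓ)]
    rw [hMdef]; nlinarith
  have hMpos : 0 < M := by linarith
  set κ₁ : ℝ := (d + 1) * D1 hprof / M with hκ₁
  set κ₂ : ℝ := (d + 1) * (D2 hprof / M ^ 2) with hκ₂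
  have hκ₁0 : 0 ≤ κ₁ := by positivity
  set X : ℝ := Real.exp (-(δ' * Dd / (((ℓ + 1) ^ k : ℕ) : ℝ))) with hX
  have hX0 : 0 < X := Real.exp_pos _
  -- the decaying pointwise bound of each cube term
  have hterm : ∀ q : ↥(ctrs P), |(bPad ℓ k Mh P aj a m2 Λ hP q *ᵥ g) x| ≤ C * (κ₁ + κ₂) * X * F := by
    intro q
    have hM' : ∀ i, 1 ≤ cubeM' Mh P q.1 i := fun i =>
      Nat.one_le_iff_ne_zero.2 (Nat.mul_ne_zero_iff.2 ⟨by omega, by have := (one_le_cubeW hP q.2 i).1; omega⟩)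
    have hinj := emb_injective (ℓ := ℓ) (k := k) (Mh := Mh) hP q.2
    unfold bPad
    rw [← Matrix.mulVec_mulVec, ← Matrix.mulVec_mulVec]
    by_cases hx : ∃ z, emb ℓ k Mh P q.1 hP q.2 z = x
    · obtain ⟨z, rfl⟩ := hx
      rw [transpose_res_mulVec_img hinj, ← Matrix.mulVec_mulVec, ← Matrix.mulVec_mulVec]
      have hLip : ∀ w w' : ↥(Box d ℓ k (fun i => (ℓ + 1) * cubeM' Mh P q.1 i)),
          |hLoc ℓ k Mh P q.1 w' - hLoc ℓ k Mh P q.1 w| ≤ κ₁ * supNorm (w'.1 - w.1) / (((ℓ + 1) ^ k : ℕ) : ℝ) := by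
        intro w w'
        have := abs_hq_sub_le (d := d) hn1 (Nat.one_le_iff_ne_zero.2 (by positivity : (ℓ + 1) * Mh ≠ 0))
          (locLabel q.1) w.1 w'.1
        rw [hκ₁, hMdef]
        push_cast at this ⊢
        exact this
      have hLap : ∀ w : ↥(Box d ℓ k (fun i => (ℓ + 1) * cubeM' Mh P q.1 i)),
          |((((ℓ + 1) ^ k : ℕ) : ℝ)) ^ 2 * ∑ w' ∈ boxNbrs _ w, (hLoc ℓ k Mh P q.1 w' - hLoc ℓ k Mh P q.1 w)| ≤ κ₂ := by
        intro w
        obtain hcw := fun i => cubeW_cases hP q.2 i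
        have hl := hloc_laplacian (d := d) (n := (ℓ + 1) ^ k) (M := (ℓ + 1) * Mh) hN4 (c := locLabel q.1)
          (w := fun i => cubeW P q.1 i) (S := fun i => (ℓ + 1) ^ k * ((ℓ + 1) * cubeM' Mh P q.1 i))
          (fun i => by simp only [cubeM']; ring) (fun i => (hcw i).1) (fun i => (hcw i).2) w
        rw [abs_mul, abs_of_nonneg (by positivity)]
        have hNsq : ((((ℓ + 1) ^ k : ℕ) : ℝ)) ^ 2 * ((d + 1) * (D2 hprof / ((((ℓ + 1) ^ k * ((ℓ + 1) * Mh) : ℕ) : ℝ)) ^ 2))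
            = κ₂ := by
          rw [hκ₂, hMdef]; push_cast
          have : (((ℓ : ℝ) + 1) ^ k) ≠ 0 := by positivity
          field_simp
        calc ((((ℓ + 1) ^ k : ℕ) : ℝ)) ^ 2 * |∑ w' ∈ boxNbrs _ w, (hLoc ℓ k Mh P q.1 w' - hLoc ℓ k Mh P q.1 w)|
            ≤ ((((ℓ + 1) ^ k : ℕ) : ℝ)) ^ 2 * ((d + 1) * (D2 hprof / ((((ℓ + 1) ^ k * ((ℓ + 1) * Mh) : ℕ) : ℝ)) ^ 2)) :=
              mul_le_mul_of_nonneg_left hl (by positivity)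
          _ = κ₂ := hNsq
      have hgq : ∀ w, |(Matrix.diagonal (hLoc ℓ k Mh P q.1) *ᵥ (res (emb ℓ k Mh P q.1 hP q.2) *ᵥ g)) w| ≤ F := by
        intro w
        rw [Matrix.mulVec_diagonal, res_mulVec, abs_mul]
        calc |hLoc ℓ k Mh P q.1 w| * |g (emb ℓ k Mh P q.1 hP q.2 w)| ≤ 1 * F :=
              mul_le_mul (abs_hq_le_one _ _ _ _) (hg _) (abs_nonneg _) zero_le_one
          _ = F := one_mul _
      have hDq : ∀ w, (Matrix.diagonal (hLoc ℓ k Mh P q.1) *ᵥ (res (emb ℓ k Mh P q.1 hP q.2) *ᵥ g)) w ≠ 0 →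
          Dd ≤ supNorm (z.1 - w.1) := by
        intro w hw
        rw [Matrix.mulVec_diagonal, res_mulVec] at hw
        have hgw : g (emb ℓ k Mh P q.1 hP q.2 w) ≠ 0 := fun h0 => hw (by rw [h0, mul_zero])
        have := hD _ hgw
        rwa [emb_sub_emb hP q.2] at this
      exact h244 k hk aj m2 a e1 e2 e3 e4 e5 e6 (cubeM' Mh P q.1) hM' (lamLoc ℓ Mh P q.1 hP q.2 Λ)
        (isBlockUnion_lamLoc hP q.2 hΛ) (hLoc ℓ k Mh P q.1) κ₁ κ₂ hκ₁0 hLip hLap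
        (Matrix.diagonal (hLoc ℓ k Mh P q.1) *ᵥ (res (emb ℓ k Mh P q.1 hP q.2) *ᵥ g)) F Dd hgq z hDq
    · push Not at hx
      rw [transpose_res_mulVec_off _ _ hx, abs_zero]
      positivity
  -- the rows: at most `2^{d+1}` non-zero terms
  rw [B6Eq250.rOp_eq_sum_bTerm, Matrix.sum_mulVec, Finset.sum_apply]
  refine (Finset.abs_sum_le_sum_abs _ _).trans ?_
  have hb : ∀ q : ↥(ctrs P), B6Eq250.bTerm (twoLevelOp ((ℓ + 1) ^ k) ℓ aj a m2 (fun i => Mh * P i) Λ)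
      (hDiag ℓ k Mh P) (gPad ℓ k Mh P aj a m2 Λ hP) q = bPad ℓ k Mh P aj a m2 Λ hP q := fun q => by
    rw [B6Eq250.bTerm_apply]; exact bTerm_eq_bPad hℓ hk hMh1 hΛ q
  simp_rw [hb]
  have key := sum_le_card_mul (fun q : ↥(ctrs P) => |(bPad ℓ k Mh P aj a m2 Λ hP q *ᵥ g) x|)
    (fun q => q.1) Subtype.val_injective (near ((ℓ + 1) ^ k * ((ℓ + 1) * Mh)) x.1)
    (fun q hq0 => mem_near_of_abs_lt hN1 (abs_lt_of_bPad_ne_zero hℓ hMh hP aj a m2 hΛ q g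
      (fun h0 => hq0 (by rw [h0, abs_zero]))))
    (by positivity : 0 ≤ C * (κ₁ + κ₂) * X * F) hterm
  refine key.trans ?_
  have hcard : ((near ((ℓ + 1) ^ k * ((ℓ + 1) * Mh)) x.1).card : ℝ) ≤ 2 ^ (d + 1) := by
    exact_mod_cast card_near_le _ _
  have hκ : κ₁ + κ₂ ≤ (d + 1) * (D1 hprof + D2 hprof) / M := by
    rw [hκ₁, hκ₂]
    have hM2 : D2 hprof / M ^ 2 ≤ D2 hprof / M := by
      apply div_le_div_of_nonneg_left hD2 hMpos
      nlinarith
    have : (d + 1) * (D2 hprof / M ^ 2) ≤ (d + 1) * (D2 hprof / M) := mul_le_mul_of_nonneg_left hM2 (by positivity)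
    calc (d + 1) * D1 hprof / M + (d + 1) * (D2 hprof / M ^ 2)
        ≤ (d + 1) * D1 hprof / M + (d + 1) * (D2 hprof / M) := by linarith
      _ = (d + 1) * (D1 hprof + D2 hprof) / M := by field_simp
  have hXF : 0 ≤ X * F := by positivity
  calc ((near ((ℓ + 1) ^ k * ((ℓ + 1) * Mh)) x.1).card : ℝ) * (C * (κ₁ + κ₂) * X * F)
      ≤ 2 ^ (d + 1) * (C * (κ₁ + κ₂) * X * F) := by
        have : 0 ≤ C * (κ₁ + κ₂) * X * F := by positivity
        nlinarith
    _ = (2 ^ (d + 1) * C * (κ₁ + κ₂)) * (X * F) := by ring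
    _ ≤ (2 ^ (d + 1) * C * ((d + 1) * (D1 hprof + D2 hprof) / M)) * (X * F) := by gcongr
    _ = (2 ^ (d + 1) * C * ((d + 1) * (D1 hprof + D2 hprof))) / M * X * F := by ring
    _ ≤ (2 ^ (d + 1) * C * ((d + 1) * (D1 hprof + D2 hprof)) + 1) / M * X * F := by gcongr; linarith

end Ineq251

end

end Literature.MathematicalPhysics.QuantumFieldTheory.Balaban1983to89.B6Ineq249TwoLevelBox
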